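import Mathlib
import Literature.Analysis.FluidPDE.VectorCalculus
import HarnessLib

/-!
# Shelf crux `EnstrophyQuarterLaw` (stmt-NavierStokesRegularity-1574), line «sparse_sieve»:
# the five typed pieces of the registered skeleton, as importable predicates

Definitions file (`--supports stmt-NavierStokesRegularity-1574`). The skeleton of record
`Cruxes/EnstrophyQuarterLaw/Lines/sparse_sieve.lean` (registered sha `3cd087f404df…`, 2026-08-28) states its
six stubs through five predicates of ONE solution `u` on `[0, T)` — `UniformLocalTypeI`, `UniformSparseness`,
`SmoothingEnvelope`, `FarFieldEnstrophy`, `WindowLaw` — declared locally in the skeleton module, which no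
`Theorems/` file may import. The CONTENT of stubs 3/4/5 (`stub_smoothingEnvelope`, `stub_farFieldEnstrophy`,
`stub_sieve`) landed on 2026-08-28 with these predicates unfolded (`…Theorems.EnstrophyQuarterLaw.SparseSieve.*`,
p614511 / p607039 / p612439), and the no-loss certificates for stubs 1/2 (p619704, p816570/p816651) are likewise
stated unfolded. This file carries the five predicates VERBATIM (same binder names, same bodies, same order as in
the skeleton) into the importable namespace `…Theorems.EnstrophyQuarterLaw.SparseSieve`, so that Theorems files can
state the registered stub signatures literally (`… → SmoothingEnvelope T u`) and the landed content theorems retire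
the registered stubs by name. Each predicate is a property of a HYPOTHETICAL first blow-up `u` on `[0,T)`; two of
them (`UniformLocalTypeI`, `UniformSparseness`) are OPEN at a first blow-up, two are known mathematics proved in the
tree for every first blow-up (`SmoothingEnvelope`, `FarFieldEnstrophy`), and `WindowLaw` is the crux's conclusion in
window form. HONEST FRAMING: definitions only; no statement about Navier–Stokes regularity, and the crux
`EnstrophyQuarterLaw` (1574) stays OPEN. Texts: planner ns-idea-9 g0/g2 (skeleton author), unchanged.
-/

noncomputable section

-- the summit and its single sub-problem share the name (CONVENTIONS §1), as in every Theorems file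
set_option linter.dupNamespace false

namespace Summit.NavierStokesRegularity.NavierStokesRegularity.Theorems.EnstrophyQuarterLaw.SparseSieve

open MeasureTheory Set Metric
open Literature.Analysis.FluidPDE
open scoped ENNReal

/-- **(CT) Uniform local Type I in the CKN quantities `A` and `E`** on the slab of scales `≤ r₀`
(skeleton predicate, verbatim): `R⁻¹ ∫_{B_R(x)} |u(s)|² ≤ M` for all `s < T`, `x`, `0 < R ≤ r₀`, and
`R⁻¹ ∫_{b−R²}^{b} ∫_{B_R(x)} |∇u|² ≤ M` for all final times `b ≤ T`. OPEN at a first blow-up (holds on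
Type-I / DSS strata; Seregin 2014 notes Def. 3.5 / (3.3.15)); implied by the crux (p619704). -/
def UniformLocalTypeI (T : ℝ) (u : ℝ → EuclideanSpace ℝ (Fin 3) → EuclideanSpace ℝ (Fin 3)) : Prop :=
  ∃ M r₀ : ℝ, 0 < M ∧ 0 < r₀ ∧
    (∀ s ∈ Set.Ico 0 T, ∀ (x : EuclideanSpace ℝ (Fin 3)), ∀ R ∈ Set.Ioc 0 r₀,
      ∫⁻ y in Metric.ball x R, ‖u s y‖ₑ ^ 2 ≤ ENNReal.ofReal (M * R)) ∧
    (∀ b ∈ Set.Ioc 0 T, ∀ (x : EuclideanSpace ℝ (Fin 3)), ∀ R ∈ Set.Ioc 0 r₀, R ^ 2 ≤ b →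
      ∫⁻ t in Set.Ioo (b - R ^ 2) b, ∫⁻ y in Metric.ball x R, ‖fderiv ℝ (u t) y‖ₑ ^ 2 ≤
        ENNReal.ofReal (M * R))

/-- **(BM) Uniform sparseness of critical concentration AT EVERY THRESHOLD** ("no satellite
swarms"; skeleton predicate, verbatim): there is a scale `r₀ > 0` such that for EVERY threshold
`ε₀ > 0` some `N₀ = N₀(ε₀)` bounds, at every time `t < T` and every scale `0 < r ≤ r₀`, the size of
any `4r`-separated finite family of centres whose `2r`-balls each carry `∫ |u(t)|³ ≥ ε₀³`. OPEN at a
first blow-up in the regime `r → 0`, `t → T` (unconditional at scales `≥ r_min`, p816691); implied by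
the crux (p816651). -/
def UniformSparseness (T : ℝ) (u : ℝ → EuclideanSpace ℝ (Fin 3) → EuclideanSpace ℝ (Fin 3)) : Prop :=
  ∃ r₀ : ℝ, 0 < r₀ ∧ ∀ ε₀ : ℝ, 0 < ε₀ → ∃ N₀ : ℕ,
    ∀ t ∈ Set.Ico 0 T, ∀ r ∈ Set.Ioc 0 r₀, ∀ F : Finset (EuclideanSpace ℝ (Fin 3)),
      (∀ x ∈ F, ∀ y ∈ F, x ≠ y → 4 * r ≤ dist x y) →
      (∀ x ∈ F, ENNReal.ofReal (ε₀ ^ 3) ≤ ∫⁻ y in Metric.ball x (2 * r), ‖u t y‖ₑ ^ 3) →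
      F.card ≤ N₀

/-- **(SE) Smoothing envelope = localized smoothing, quantitative and rescaled** (skeleton predicate,
verbatim; Barker–Prange 2020 Thm 1 / Kang–Miura–Tsai 2021 Thm 1.1 + interior gradient bound): given a
scale-`r₀` local energy bound with constant `M`, there are `γ, σ > 0` and `C` such that for every final
time `b ≤ T`, centre `x₀` and scale `0 < R ≤ r₀` with restart time `b − σR² ≥ 0`, smallness
`∫_{B_{2R}(x₀)} |u(b − σR²)|³ ≤ γ³` forces `∫_{t₁}^{b} ∫_{B_{R/4}(x₀)} |∇u|² ≤ C (b − t₁)/R` for all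
`t₁ ∈ [b − σR²/4, b)`. KNOWN; proved for every first blow-up in the tree (p614511). -/
def SmoothingEnvelope (T : ℝ) (u : ℝ → EuclideanSpace ℝ (Fin 3) → EuclideanSpace ℝ (Fin 3)) : Prop :=
  ∀ M r₀ : ℝ, 0 < M → 0 < r₀ →
    (∀ s ∈ Set.Ico 0 T, ∀ (x : EuclideanSpace ℝ (Fin 3)), ∀ R ∈ Set.Ioc 0 r₀,
      ∫⁻ y in Metric.ball x R, ‖u s y‖ₑ ^ 2 ≤ ENNReal.ofReal (M * R)) →
    ∃ γ σ C : ℝ, 0 < γ ∧ 0 < σ ∧ 0 ≤ C ∧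
      ∀ (b R : ℝ) (x₀ : EuclideanSpace ℝ (Fin 3)), 0 < R → R ≤ r₀ → 0 ≤ b - σ * R ^ 2 → b ≤ T →
        ∫⁻ y in Metric.ball x₀ (2 * R), ‖u (b - σ * R ^ 2) y‖ₑ ^ 3 ≤ ENNReal.ofReal (γ ^ 3) →
        ∀ t₁ ∈ Set.Ico (b - σ * R ^ 2 / 4) b,
          ∫⁻ t in Set.Ioo t₁ b, ∫⁻ y in Metric.ball x₀ (R / 4), ‖fderiv ℝ (u t) y‖ₑ ^ 2 ≤
            ENNReal.ofReal (C * (b - t₁) / R)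

/-- **(FF) Far-field enstrophy bound** on the second half of the life span (skeleton predicate,
verbatim): outside some ball the enstrophy stays bounded up to `T` (Tao 2011/2013 Thm 10.1 in the
exterior form of Rem. 10.6). KNOWN; proved for every first blow-up in the tree (p607039). -/
def FarFieldEnstrophy (T : ℝ) (u : ℝ → EuclideanSpace ℝ (Fin 3) → EuclideanSpace ℝ (Fin 3)) : Prop :=
  ∃ ρ B : ℝ, 0 ≤ B ∧ ∀ t ∈ Set.Ico (T / 2) T,
    ∫⁻ x in (Metric.ball (0 : EuclideanSpace ℝ (Fin 3)) ρ)ᶜ, ‖curl (u t) x‖ₑ ^ 2 ≤ ENNReal.ofReal B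

/-- The crux's conclusion for one solution in window form (skeleton predicate, verbatim): the
**window quarter law** `∫_a^b ∫ |curl u|² ≤ K √(b − a)` for `0 ≤ a ≤ b ≤ T` (energy `½`-Hölder). -/
def WindowLaw (T : ℝ) (u : ℝ → EuclideanSpace ℝ (Fin 3) → EuclideanSpace ℝ (Fin 3)) : Prop :=
  ∃ K : ℝ, ∀ a b : ℝ, 0 ≤ a → a ≤ b → b ≤ T →
    ∫⁻ t in Set.Ioo a b, ∫⁻ x, ‖curl (u t) x‖ₑ ^ 2 ≤ ENNReal.ofReal (K * Real.sqrt (b - a))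

end Summit.NavierStokesRegularity.NavierStokesRegularity.Theorems.EnstrophyQuarterLaw.SparseSieve

end
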